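/-
Copyright (c) 2026 the pub-hodgecm-mathlib formalisation cell (harness21).  Prover seat hodgecm-mathlib-K2E3-p17 (g8), Track B «K2-LIT» ∕ h413
(`stmt-HodgeConjecture-24833`), line `K2_E3_EllipticInputs`, leaf (nsc-S-A′), glue brick LIFT (D94, census `CENSUS-C1prime.v0` §6 (6d)) for the case bricks C1′∕C1″∕C2 of
`MEMO-SA-architecture.v2.K2E3-p25-g2.md` §3.  2026-09-04.
-/
import Literature.NumberTheory.Automorphic.JacquetGLFunctor                          -- ★ `jacquetGLMap`, `jacquetGLMap_injective∕_surjective`, `IntertwiningMap.rangeInverse`, `codRestrictSubrep`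
import Literature.NumberTheory.Automorphic.ParabolicInductionModulusProofs          -- ★ `IsSmooth.jacquetGL`
import Literature.NumberTheory.Automorphic.ParabolicInductionCuspidalSupportProofs  -- ★ `isSupercuspidal_of_forall_cut`, `cutUnipotent`
import Literature.NumberTheory.Automorphic.AdmissibleSubquotient                     -- ★ `IsSmooth.toRepresentation`; brings `Subrepresentation.quotientRep`, `subtypeIntertwiningMap`
import HarnessLib

/-!
# Crux `H413` — leaf (nsc-S-A′), glue brick LIFT: the weak cell lemma `h3cell` PROPAGATES TO SUBQUOTIENTS — Jacquet modules of subquotients of `I(χ)` have no cuspidal pieces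

Cell `hodgecm-mathlib`, Track B; THEOREMS ONLY; count-neutral helper (`--supports stmt-HodgeConjecture-24833 --as helper`).

★ E4a (`K2E3GL3PrincipalSeriesConstituentsJacquetNonzero`) carries the hypothesis `h3cell`: for `c : Fin 3 → Fin 2` monotone surjective, NO irreducible smooth supercuspidal `σ` of the
block Levi `M_c` (on a space in `Type`) receives a non-zero map from a SUBREPRESENTATION of `r_c(I)` (`I` a principal series).  The case bricks need the same for the Jacquet modules
of SUBQUOTIENTS `ρ` of `I` (an irreducible subquotient `ω`, a piece `P₁` of `D`, …), presented as `ρ₁ ↪ I`, `ρ₁ ↠ ρ`: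
* §1 **`intertwiningMap_subrepresentation_jacquetGL_eq_zero`** (any `n`, `c : Fin n → Fin r` monotone, `I` smooth): every `M_c`-subrepresentation `W′ ≤ r_c ρ` and every such `σ`
  have `Hom_{M_c}(W′, σ) = 0` — pull `W′` back along the SURJECTION `r_c(ρ₁) ↠ r_c(ρ)` (★ `jacquetGLMap_surjective`), push it into `r_c(I)` along the INJECTION `r_c(ρ₁) ↪ r_c(I)`
  (★ `jacquetGLMap_injective`, left exactness [BZ77, Prop. 1.9 (a)]) with ★ `IntertwiningMap.rangeInverse` (pattern of ★ E4a), and apply the cell hypothesis there.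
* §2 **`subrepresentation_jacquetGL_eq_bot_of_forall_cut`**: hence a FINITELY GENERATED `M_c`-subrepresentation `W′ ≤ r_c ρ` (`ρ` smooth) all of whose cut-Jacquet modules vanish
  (`Coinvariants.ker (W′|_{U_cut}) = ⊤`, the hypothesis shape of ★ `isSupercuspidal_of_forall_cut`) is `⊥`: a maximal proper subrepresentation (★ `exists_isCoatom_subrepresentation`)
  has an irreducible smooth quotient, supercuspidal by ★ `isSupercuspidal_of_forall_cut`, contradicting §1; and the CYCLIC form `eq_zero_of_forall_cut_cyclic` (a vector whose
  cyclic `M_c`-span has vanishing cut-Jacquet modules is `0`) — «no cuspidal vectors in `r_c ρ`».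

HONEST LABEL: HC_CM is proved only modulo the 7 printed citations (2 remaining named inputs: hLiu418 = stmt-HodgeConjecture-24832, h413 =
stmt-HodgeConjecture-24833) until rung 0 closes; count-neutral helper.

## References
* [BernsteinZelevinsky1977] I. N. Bernstein, A. V. Zelevinsky, *Induced representations of reductive p-adic groups I*, Ann. Sci. ÉNS 10 (1977), Prop. 1.9 (a), Thm. 2.5, Thm. 2.9, §2.4.
* [Casselman1995] W. Casselman, *Introduction to the theory of admissible representations of p-adic reductive groups* (draft 1995), Prop. 3.2.3, Thm. 5.1.2, Cor. 5.4.3, §6.3.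
-/

set_option autoImplicit false
-- the mandated namespace repeats `HodgeConjecture.HodgeConjecture`, as in every `Theorems/*.lean` of this sub-problem
set_option linter.dupNamespace false

noncomputable section

open Representation Function Literature.NumberTheory.Automorphic Literature.NumberTheory.GaloisRepresentations.IsNonarchimedeanLocalField
open Literature.RepresentationTheory.FiniteGroups Literature.RepresentationTheory.Semisimple
open scoped MatrixGroups

namespace Summit.HodgeConjecture.HodgeConjecture.Cruxes.H413.K2E3JacquetSubquotientNoCuspidal

variable {F : Type} [Field F] [ValuativeRel F] [TopologicalSpace F] [IsNonarchimedeanLocalField F] {n r : ℕ} {c : Fin n → Fin r}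
  {XI X₁ X : Type} [AddCommGroup XI] [Module ℂ XI] [AddCommGroup X₁] [Module ℂ X₁] [AddCommGroup X] [Module ℂ X]
  {I : Representation ℂ (GL (Fin n) F) XI} {ρ₁ : Representation ℂ (GL (Fin n) F) X₁} {ρ : Representation ℂ (GL (Fin n) F) X}

/-! ## §1 No supercuspidal quotient of a subrepresentation of `r_c` of a subquotient -/

/-- The coinvariant kernel hypothesis passes along a SURJECTIVE intertwining map, for the restriction to any subgroup `H`. [folklore] -/
theorem coinvariantsKer_comp_subtype_eq_top_of_surjective {G : Type*} [Group G] {Y₁ Y₂ : Type*} [AddCommGroup Y₁] [Module ℂ Y₁] [AddCommGroup Y₂] [Module ℂ Y₂]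
    {τ₁ : Representation ℂ G Y₁} {τ₂ : Representation ℂ G Y₂} (H : Subgroup G) (f : τ₁.IntertwiningMap τ₂) (hf : Function.Surjective f)
    (h : Coinvariants.ker (τ₁.comp H.subtype) = ⊤) : Coinvariants.ker (τ₂.comp H.subtype) = ⊤ := by
  let fH : Representation.IntertwiningMap (τ₁.comp H.subtype) (τ₂.comp H.subtype) := ⟨f.toLinearMap, fun h => f.isIntertwining' (h : G)⟩
  refine eq_top_iff.2 fun y _ => ?_
  obtain ⟨x, rfl⟩ := hf y
  have hx : Coinvariants.mk (τ₁.comp H.subtype) x = 0 := (Coinvariants.mk_eq_zero _).2 (h ▸ Submodule.mem_top)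
  have h2 : Coinvariants.map _ _ fH (Coinvariants.mk (τ₁.comp H.subtype) x) = Coinvariants.mk (τ₂.comp H.subtype) (f x) := Coinvariants.map_mk fH x
  exact (Coinvariants.mk_eq_zero _).1 (by rw [← h2, hx, map_zero])

variable (I ρ₁ ρ) in
/-- **LIFT: `h_cell` PROPAGATES TO SUBQUOTIENTS.**  Let `I` be smooth, `c` monotone, and suppose no irreducible smooth supercuspidal `σ` of the block Levi `M_c` receives a non-zero
map from a subrepresentation of `r_c(I)` (`hcell`, the shape of ★ E4a's `h3cell c hc hsurj`).  Then for every `ρ` presented as a subquotient `ρ₁ ↪ I`, `ρ₁ ↠ ρ`, every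
`M_c`-subrepresentation `W′ ≤ r_c(ρ)` and every such `σ`: every intertwining map `W′ → σ` is ZERO. [cite: BernsteinZelevinsky1977, Prop. 1.9 (a), Thm. 2.9] [cite: Casselman1995, Prop. 3.2.3] -/
theorem intertwiningMap_subrepresentation_jacquetGL_eq_zero (hc : Monotone c) (hI : I.IsSmooth)
    (hcell : ∀ (W : Type) [AddCommGroup W] [Module ℂ W] (σ : Representation ℂ (Π a, GL {i // c i = a} F) W),
      σ.IsIrreducible → σ.IsSmooth → σ.IsSupercuspidal → ∀ (N : Subrepresentation (jacquetGL F c I)) (q : N.toRepresentation.IntertwiningMap σ), q = 0)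
    (ι : ρ₁.IntertwiningMap I) (hι : Function.Injective ι) (π : ρ₁.IntertwiningMap ρ) (hπ : Function.Surjective π)
    (W' : Subrepresentation (jacquetGL F c ρ)) {W : Type} [AddCommGroup W] [Module ℂ W] (σ : Representation ℂ (Π a, GL {i // c i = a} F) W)
    (hσi : σ.IsIrreducible) (hσs : σ.IsSmooth) (hσc : σ.IsSupercuspidal) (f : W'.toRepresentation.IntertwiningMap σ) : f = 0 := by
  classical
  have hjι : Function.Injective (jacquetGLMap F c ι) := jacquetGLMap_injective hc hI ι hι
  have hjπ : Function.Surjective (jacquetGLMap F c π) := jacquetGLMap_surjective π hπ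
  -- pull `W'` back to `r_c(ρ₁)`
  let Wt : Subrepresentation (jacquetGL F c ρ₁) :=
    ⟨W'.toSubmodule.comap (jacquetGLMap F c π).toLinearMap, fun m x hx => by
      simp only [Submodule.mem_comap, Representation.IntertwiningMap.toLinearMap_apply] at hx ⊢
      rw [(jacquetGLMap F c π).isIntertwining]
      exact W'.apply_mem_toSubmodule m hx⟩
  -- the restriction `Wt ↠ W'` of `r_c(π)`
  let πW : Wt.toRepresentation.IntertwiningMap W'.toRepresentation :=
    ((jacquetGLMap F c π).comp (Subrepresentation.subtypeIntertwiningMap Wt)).codRestrictSubrep W' fun x => x.2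
  have hπW : Function.Surjective πW :=
    Representation.IntertwiningMap.codRestrictSubrep_surjective _ _ _ fun w hw => by
      obtain ⟨x, hx⟩ := hjπ w
      exact ⟨⟨x, show (jacquetGLMap F c π) x ∈ W' by rw [hx]; exact hw⟩, hx⟩
  -- push `Wt` into `r_c(I)`: `N = r_c(ι)(Wt)`, with `Wt ≅ N`
  let j : Wt.toRepresentation.IntertwiningMap (jacquetGL F c I) := (jacquetGLMap F c ι).comp (Subrepresentation.subtypeIntertwiningMap Wt)
  have hj : Function.Injective j := hjι.comp (Subrepresentation.subtypeIntertwiningMap_injective Wt)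
  let q : j.range.toRepresentation.IntertwiningMap σ := (f.comp πW).comp (j.rangeInverse hj)
  have hq : q = 0 := hcell W σ hσi hσs hσc j.range q
  -- so `f ∘ πW = 0`, and `πW` is surjective
  refine Representation.IntertwiningMap.toLinearMap_injective _ _ (LinearMap.ext fun y => ?_)
  obtain ⟨x, rfl⟩ := hπW y
  obtain ⟨z, rfl⟩ := Representation.IntertwiningMap.rangeInverse_surjective j hj x
  have h1 : q z = 0 := by rw [hq]; rfl
  exact h1

/-! ## §2 Finitely generated subrepresentations of `r_c(ρ)` with vanishing cut-Jacquet modules are zero -/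

variable (I ρ₁ ρ) in
/-- **A finitely generated `M_c`-subrepresentation of `r_c(ρ)` whose cut-Jacquet modules all vanish is `⊥`** (`ρ` smooth, a subquotient of the smooth `I` carrying `hcell`): otherwise a
maximal proper subrepresentation (★ `exists_isCoatom_subrepresentation`) has an IRREDUCIBLE smooth quotient `σ`, whose cut-Jacquet modules vanish too, so `σ` is SUPERCUSPIDAL
(★ `isSupercuspidal_of_forall_cut`, Harish-Chandra ∕ [BZ77, §2.4]) — and the quotient map `W′ ↠ σ ≠ 0` contradicts §1. [cite: BernsteinZelevinsky1977, Thm. 2.5, §2.4, Thm. 2.9]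
[cite: Casselman1995, Thm. 5.1.2, §6.3] -/
theorem subrepresentation_jacquetGL_eq_bot_of_forall_cut (hc : Monotone c) (hI : I.IsSmooth)
    (hcell : ∀ (W : Type) [AddCommGroup W] [Module ℂ W] (σ : Representation ℂ (Π a, GL {i // c i = a} F) W),
      σ.IsIrreducible → σ.IsSmooth → σ.IsSupercuspidal → ∀ (N : Subrepresentation (jacquetGL F c I)) (q : N.toRepresentation.IntertwiningMap σ), q = 0)
    (ι : ρ₁.IntertwiningMap I) (hι : Function.Injective ι) (π : ρ₁.IntertwiningMap ρ) (hπ : Function.Surjective π) (hρ : ρ.IsSmooth)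
    (W' : Subrepresentation (jacquetGL F c ρ)) [Module.Finite (MonoidAlgebra ℂ (Π a, GL {i // c i = a} F)) W'.toRepresentation.asModule]
    (hQC : ∀ p q : Fin n, p < q → c q = c p → Coinvariants.ker (W'.toRepresentation.comp (cutUnipotent F c p).subtype) = ⊤) : W' = ⊥ := by
  classical
  haveI : IsTopologicalRing F := inferInstance
  by_contra hne
  haveI : Nontrivial ↥W'.toSubmodule := Submodule.nontrivial_iff_ne_bot.2 fun h => hne (Subrepresentation.toSubmodule_injective h)
  obtain ⟨N₂, hN₂⟩ := Representation.exists_isCoatom_subrepresentation W'.toRepresentation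
  have hirr : N₂.quotientRep.IsIrreducible := Subrepresentation.isIrreducible_quotientRep hN₂
  have hsmW : W'.toRepresentation.IsSmooth := (hρ.jacquetGL F c).toRepresentation W'
  have hsm : N₂.quotientRep.IsSmooth := hsmW.quotientRep N₂
  have hsc : N₂.quotientRep.IsSupercuspidal :=
    Representation.isSupercuspidal_of_forall_cut N₂.quotientRep hc hsm fun p q hpq hq =>
      coinvariantsKer_comp_subtype_eq_top_of_surjective _ N₂.mkQ N₂.mkQ_surjective (hQC p q hpq hq)
  have h0 := intertwiningMap_subrepresentation_jacquetGL_eq_zero I ρ₁ ρ hc hI hcell ι hι π hπ W' N₂.quotientRep hirr hsm hsc N₂.mkQ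
  -- `N₂.mkQ = 0` contradicts surjectivity onto the non-zero quotient
  haveI : Nontrivial (↥W'.toSubmodule ⧸ N₂.toSubmodule) := Representation.IsIrreducible.nontrivial N₂.quotientRep
  obtain ⟨y, hy⟩ := exists_ne (0 : ↥W'.toSubmodule ⧸ N₂.toSubmodule)
  obtain ⟨x, rfl⟩ := N₂.mkQ_surjective y
  exact hy (by rw [h0]; rfl)

variable (I ρ₁ ρ) in
/-- **NO CUSPIDAL VECTORS IN `r_c(ρ)`**, cyclic form: a vector of `r_c(ρ)` whose CYCLIC `M_c`-span has vanishing cut-Jacquet modules is zero (§2 for the finitely generated cyclic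
subrepresentation `ℂ[M_c] · x`, Mathlib `Subrepresentation.ofSubmodule'` ∕ `Module.Finite.span_singleton`). [cite: BernsteinZelevinsky1977, Thm. 2.5, §2.4] [cite: Casselman1995, §6.3] -/
theorem eq_zero_of_forall_cut_cyclic (hc : Monotone c) (hI : I.IsSmooth)
    (hcell : ∀ (W : Type) [AddCommGroup W] [Module ℂ W] (σ : Representation ℂ (Π a, GL {i // c i = a} F) W),
      σ.IsIrreducible → σ.IsSmooth → σ.IsSupercuspidal → ∀ (N : Subrepresentation (jacquetGL F c I)) (q : N.toRepresentation.IntertwiningMap σ), q = 0)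
    (ι : ρ₁.IntertwiningMap I) (hι : Function.Injective ι) (π : ρ₁.IntertwiningMap ρ) (hπ : Function.Surjective π) (hρ : ρ.IsSmooth)
    (x : (restrictUnipotentGL F c ρ).Coinvariants)
    (hQC : ∀ p q : Fin n, p < q → c q = c p →
      Coinvariants.ker ((Subrepresentation.ofSubmodule' (ρ := jacquetGL F c ρ)
        (Submodule.span (MonoidAlgebra ℂ (Π a, GL {i // c i = a} F)) {(jacquetGL F c ρ).asModuleEquiv.symm x})).toRepresentation.comp (cutUnipotent F c p).subtype) = ⊤) :
    x = 0 := by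
  set S : Submodule (MonoidAlgebra ℂ (Π a, GL {i // c i = a} F)) (jacquetGL F c ρ).asModule :=
    Submodule.span (MonoidAlgebra ℂ (Π a, GL {i // c i = a} F)) {(jacquetGL F c ρ).asModuleEquiv.symm x} with hS
  set C : Subrepresentation (jacquetGL F c ρ) := Subrepresentation.ofSubmodule' S with hC
  have hxS : (jacquetGL F c ρ).asModuleEquiv.symm x ∈ S := Submodule.subset_span (Set.mem_singleton _)
  have hxC : x ∈ C := hxS
  haveI : Module.Finite (MonoidAlgebra ℂ (Π a, GL {i // c i = a} F)) ↥S := Module.Finite.span_singleton _ _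
  have hS' : S = C.asSubmodule := rfl
  haveI : Module.Finite (MonoidAlgebra ℂ (Π a, GL {i // c i = a} F)) C.toRepresentation.asModule :=
    Module.Finite.equiv ((LinearEquiv.ofEq _ _ hS').trans (Subrepresentation.asModuleEquiv C).symm)
  have hbot := subrepresentation_jacquetGL_eq_bot_of_forall_cut I ρ₁ ρ hc hI hcell ι hι π hπ hρ C hQC
  have : x ∈ (⊥ : Subrepresentation (jacquetGL F c ρ)) := hbot ▸ hxC
  exact this

end Summit.HodgeConjecture.HodgeConjecture.Cruxes.H413.K2E3JacquetSubquotientNoCuspidal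

end
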